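import Mathlib
import Literature.MathematicalPhysics.StatisticalMechanics.Crystallization
import Summits.AtomisticToContinuum.Crystallization.Theses.ThreeConeCertificate
import Summits.AtomisticToContinuum.Crystallization.Theorems.ThreeConeCertificateExactCertificateAllTemplates

/-!
# Crux `ExactCertificate` (stmt-AtomisticToContinuum-11959), line `closure-makes-nogap-exact`, lead c10:
# skeleton X — ALL TEMPLATES (`AllTemplates`): the commensurability caveat of skeletons VIII–IX removed by a Vandermonde window argument

Skeleton X v2 (c10, 2026-08-17 18:25Z) — SORRY-FREE: all five registered stubs LANDED (X1 `stub_expSumWindow` p168283, X2 `stub_structureFactorWindows`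
p168378, X3 `stub_normsSuperlinearWindow` p168400, `stub_allTemplatesKernel` p168618, `stub_allTemplatesAssembly` p168743) and are imported; the deciding
statement is closed below by the landed assembly.  v1 (17:50Z): composition proved modulo X1–X3.

The 3-D line is parked (crux = `NoGap ∧ KeplerBound`, `KeplerBound` = item 11961 ↔ 0627 open).  Skeletons VIII (invisibility dichotomy) and IX
(slack cone active beyond every radius) needed the template's motif to be COMMENSURATE (so that the structure factor does not vanish on a whole
dilated dual plane).  This skeleton removes the caveat for EVERY periodic configuration of ℝ³ without equidistribution: on each lattice line
`n ↦ n k₁ + j k₂` the structure factor `S(n, j) = Σ_{x ∈ motif} α_x^n β_x^j` is an exponential sum with at most `#motif` distinct nodes, so by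
Vandermonde it is either identically zero on the line or non-zero somewhere in EVERY window of `#motif` consecutive `n`
(`stub_expSumWindow`), and lines on which it is not identically zero occur in every window of `#motif` consecutive `j` (the class of any motif
point contributes a sum of unimodular nodes with POSITIVE INTEGER multiplicities) — `stub_structureFactorWindows`.  Zeros of the entire slice on
such a WINDOW-DENSE set of a dual plane are still superlinear (`stub_normsSuperlinearWindow`), so the engine of skeleton VIII runs.

  `AllTemplates` := (for every periodic `P ⊂ ℝ³`, no nonzero finite-range continuous radial kernel is invisible to `P`)
                 ∧ (for every exact three-cone certificate of the crux with measurable `f`, at ANY template, the slack cone is active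
                    beyond every radius).
-/

noncomputable section

namespace Summit.AtomisticToContinuum.Crystallization.Cruxes.ExactCertificate.AllTemplates

open Literature.MathematicalPhysics.StatisticalMechanics MeasureTheory Set Filter Topology
open Summit.AtomisticToContinuum.Crystallization.Theorems.ThreeConeCertificateExactCertificate.AllTemplates
open scoped BigOperators FourierTransform RealInnerProductSpace

/-! ## The stubs: ALL LANDED (imported; namespace `…Theorems.ThreeConeCertificateExactCertificate.AllTemplates`):
`stub_expSumWindow` (X1, p168283), `stub_structureFactorWindows` (X2, p168378), `stub_normsSuperlinearWindow` (X3, p168400),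
`stub_allTemplatesKernel` (part I, lead, p168618), `stub_allTemplatesAssembly` (part II, lead, p168743). -/

/-- **The deciding statement of skeleton X: ALL TEMPLATES.**  (i) For EVERY periodic configuration `P ⊂ ℝ³`, every continuous
`α : ℝ → ℝ` vanishing on `[L, ∞)` whose field `Σ_{y ∈ P} α(dist w y)` vanishes at every `w` is `≡ 0` on `[0, ∞)`.  (ii) For EVERY exact
three-cone certificate `(P, ρ, c, g, U, f)` of the crux (six clauses verbatim) with measurable `f` — any template — and every radius `ρ′`,
there is `r ≥ ρ′` with `U r ≠ 0`. -/
def AllTemplates : Prop :=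
  (∀ (P : PeriodicConfiguration 3) (α : ℝ → ℝ) (L : ℝ), Continuous α → (∀ r : ℝ, L ≤ r → α r = 0) →
      (∀ w : EuclideanSpace ℝ (Fin 3),
        HasSum (fun y : P.points => α (dist w (y : EuclideanSpace ℝ (Fin 3)))) 0) →
      ∀ r : ℝ, 0 ≤ r → α r = 0) ∧
  (∀ (P : PeriodicConfiguration 3) (ρ c : ℝ) (g U f : ℝ → ℝ),
    (∀ r : ℝ, 0 < r → lennardJones r = g r + U r + f r) → (∀ r : ℝ, 0 < r → 0 ≤ U r) →
    (∀ r : ℝ, ρ ≤ r → g r = 0) →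
    (∀ (n : ℕ) (y : Fin n → EuclideanSpace ℝ (Fin 3)) (w : Fin n → ℝ),
      0 ≤ ∑ i, ∑ j, w i * w j * f (dist (y i) (y j))) →
    (∀ (N : ℕ) (x : Fin N → EuclideanSpace ℝ (Fin 3)), Function.Injective x →
      -(c * (N : ℝ)) ≤ interactionEnergy g x) →
    c + f 0 / 2 = -(P.energyPerParticle lennardJones) →
    Measurable f → ∀ ρ' : ℝ, ∃ r : ℝ, ρ' ≤ r ∧ U r ≠ 0)

/-- **Composition: the landed assembly closes `AllTemplates`** (statement = definiens verbatim). -/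
theorem AllTemplates_of : AllTemplates := stub_allTemplatesAssembly

end Summit.AtomisticToContinuum.Crystallization.Cruxes.ExactCertificate.AllTemplates

end
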